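import Summits.RiemannHypothesis.RiemannHypothesis.Theses.SignCone
import Summits.RiemannHypothesis.RiemannHypothesis.Theorems.SignConeFakeWeightReduction
import Literature.NumberTheory.LFunctions.WeilMarkovQuadratic
import Literature.NumberTheory.LFunctions.WeilMellinBounds

/-!
# `ConeMagnification`: reduction to ONE fake weight for all cutoffs (slack-cone compactness)
(route `SignCone`, item stmt-RiemannHypothesis-16303 `ConeMagnification`; HELPER file, `--supports`)

The crux `ConeMagnification` assumes, at EVERY cutoff `a > 0`, SOME nonnegative weight `c_a` on `ℕ`
(`c_a(1) = 0`) whose fake Weil form has unit slack on the Weil tests supported in `[-a, a]`: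
`-‖g‖₂² ≤ Re (W_ar(g ⋆ g̃) - P_{c_a}(g ⋆ g̃))`, `W_ar = weilPolarTerm + weilArchTerm`,
`P_c(G) = Σₙ c(n) n^{-1/2} (G(log n) + G(-log n))`, and concludes RH. The 2001 proof (W-MAG) starts by
replacing the family `(c_a)_a` by a SINGLE weight `c` that works at every cutoff ("`K♭_a` compact,
decreasing in `a`, hence `⋂ₐ K♭_a ≠ ∅`"). This file proves that step, sorry-free:

* `fakeWeight_coord_le` — A-PRIORI BOUND: if `c ≥ 0` has unit slack against ONE test `φ` whose
  autocorrelation `Φ = φ ⋆ φ̃` is node-nonnegative (`Re Φ(log m) ≥ 0` for all `m`) then every coordinate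
  `n ≥ 1` with `Re Φ(log n) > 0` obeys `c(n) ≤ √n (Re W_ar(Φ) + ‖φ‖₂²) / (2 Re Φ(log n))` (all terms of
  `Re P_c(Φ)` are `≥ 0`, so the `n`-th is at most `Re W_ar(Φ) + ‖φ‖₂²`);
* `exists_uniform_fakeWeight` — COMPACTNESS: from weights `c_k` at the cutoffs `k + 1` (`k : ℕ`), the
  Slater bumps (`Re (φ ⋆ φ̃) ≥ 0`, and `> 0` on `|t| < 2a`; `exists_nodeNonneg_bump`) bound each coordinate
  uniformly in `k`, the truncated weights live in the compact metrisable box `Πₙ [0, Bₙ]`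
  (`isCompact_univ_pi`, `IsCompact.isSeqCompact`), a subsequence converges coordinatewise, and for a
  fixed test `g` only the finitely many nodes `log n < 2a` enter `P_c(g ⋆ g̃)`, so the unit-slack
  inequality passes to the limit: ONE `c ≥ 0`, `c(1) = 0`, with unit slack against EVERY Weil test
  (`exists_nodeNonneg_bump` is the Slater bump, adapted here);
* `coneMagnification_iff_uniform` — hence the route decl `ConeMagnification` is EQUIVALENT to its
  uniform form `(∃ c ≥ 0, c 1 = 0, unit slack against every Weil test) → RH` (W-MAG Thm 1.2(ii), `M = 1`),
  and `coneMagnification_of_uniform` records the reduction used by the route.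

Literature vocabulary (`IsWeilTest`, `weilConv`, `weilReflect`, `weilPolarTerm`, `weilArchTerm`) is
definitionally the Mathlib-primitive vocabulary of the item (route file, CONE NOTE; `Iff.rfl` below).
-/

noncomputable section

-- `Summit.RiemannHypothesis.RiemannHypothesis.…` repeats a namespace component by design (D-0017 layout).
set_option linter.dupNamespace false

open scoped BigOperators ComplexConjugate Topology
open Complex MeasureTheory Set Filter

namespace Summit.RiemannHypothesis.RiemannHypothesis.Theorems.SignCone

open Literature.NumberTheory.LFunctions

/-! ## The terms of a fake prime sum on an autocorrelation -/

/-- Real part of one term of `P_c(g ⋆ g̃)`: `Re (c(m) m^{-1/2} (G(log m) + G(-log m))) =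
(c(m)/√m) · 2 Re G(log m)` (`G = g ⋆ g̃` is hermitian, `conj_weilConv_weilReflect_neg`). [folklore] -/
theorem re_fakeTerm_weilConv_weilReflect (c : ℕ → ℝ) (g : ℝ → ℂ) (m : ℕ) :
    (((c m : ℝ) : ℂ) / (Real.sqrt m : ℂ) *
        (weilConv g (weilReflect g) (Real.log m) + weilConv g (weilReflect g) (-Real.log m))).re =
      c m / Real.sqrt m * (2 * (weilConv g (weilReflect g) (Real.log m)).re) := by
  have hcoef : ((c m : ℝ) : ℂ) / (Real.sqrt m : ℂ) = ((c m / Real.sqrt m : ℝ) : ℂ) := by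
    push_cast
    rfl
  have hneg : (weilConv g (weilReflect g) (-Real.log m)).re = (weilConv g (weilReflect g) (Real.log m)).re := by
    rw [← conj_weilConv_weilReflect_neg g (Real.log m), Complex.conj_re]
  rw [hcoef, Complex.re_ofReal_mul, Complex.add_re, hneg]
  ring

/-- For a Weil test `g` supported in `[-a, a]`, the fake prime sum of `g ⋆ g̃` (ANY weight) is the finite
sum over `n ≤ ⌊e^{2a}⌋`: the kernel vanishes at `± log n` once `log n ≥ 2a`. [folklore] -/
theorem fakeSum_eq_sum_range {g : ℝ → ℂ} (hg : IsWeilTest g) {a : ℝ} (hsupp : tsupport g ⊆ Icc (-a) a)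
    (c : ℕ → ℝ) :
    (∑' n : ℕ, ((c n : ℝ) : ℂ) / (Real.sqrt n : ℂ) *
        (weilConv g (weilReflect g) (Real.log n) + weilConv g (weilReflect g) (-Real.log n))) =
      ∑ n ∈ Finset.range (⌊Real.exp (2 * a)⌋₊ + 1), ((c n : ℝ) : ℂ) / (Real.sqrt n : ℂ) *
        (weilConv g (weilReflect g) (Real.log n) + weilConv g (weilReflect g) (-Real.log n)) := by
  refine tsum_eq_sum fun n hn => ?_
  rw [Finset.mem_range, not_lt] at hn
  have hn' : Real.exp (2 * a) < n :=
    (Nat.lt_floor_add_one _).trans_le (by exact_mod_cast hn)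
  have hpos : (0 : ℝ) < n := (Real.exp_pos _).trans hn'
  have hlog : 2 * a < Real.log n := (Real.lt_log_iff_exp_lt hpos).2 hn'
  have h0 : 0 ≤ Real.log n := Real.log_natCast_nonneg n
  have h1 : weilConv g (weilReflect g) (Real.log n) = 0 :=
    Literature.NumberTheory.LFunctions.weilConv_weilReflect_eq_zero_of_le_abs hg hsupp
      (by rw [abs_of_nonneg h0]; exact hlog.le)
  have h2 : weilConv g (weilReflect g) (-Real.log n) = 0 :=
    Literature.NumberTheory.LFunctions.weilConv_weilReflect_eq_zero_of_le_abs hg hsupp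
      (by rw [abs_neg, abs_of_nonneg h0]; exact hlog.le)
  rw [h1, h2, add_zero, mul_zero]

/-! ## A node-nonnegative bump, positive at every node below the cutoff -/

/-- For `a > 0` there is a Weil test `φ` with `tsupport φ ⊆ [-a, a]` whose autocorrelation `φ ⋆ φ̃` has
NON-NEGATIVE real part everywhere and POSITIVE real part on `|t| < 2a` (so at every node `log n < 2a`):
`φ = b` a smooth bump (`ContDiffBump 0`, radii `a/2 < a`), `(φ ⋆ φ̃)(t) = ∫ b(u) b(u - t) du` with a
continuous nonnegative integrand, positive at `u = t/2` when `|t| < 2a`. [folklore] -/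
theorem exists_nodeNonneg_bump {a : ℝ} (ha : 0 < a) :
    ∃ φ : ℝ → ℂ, IsWeilTest φ ∧ tsupport φ ⊆ Icc (-a) a ∧
      (∀ t : ℝ, 0 ≤ (weilConv φ (weilReflect φ) t).re) ∧
      ∀ t : ℝ, |t| < 2 * a → 0 < (weilConv φ (weilReflect φ) t).re := by
  -- adapted from `SignConeExactConeRigidityCone.exists_slater_bump` (that module is not importable
  -- together with `SignConeFakeWeightReduction`: `WeilWindowSimpleEven`/`WeilGroundStateRealZeros` clash)
  let b : ContDiffBump (0 : ℝ) := ⟨a / 2, a, by positivity, by linarith⟩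
  have hval : ∀ t : ℝ, weilConv (fun t ↦ ((b t : ℝ) : ℂ)) (weilReflect fun t ↦ ((b t : ℝ) : ℂ)) t =
      ((∫ u, b u * b (u - t) : ℝ) : ℂ) := fun t => by
    rw [weilConv_apply, ← integral_complex_ofReal]
    congr 1 with u
    simp only [weilReflect, Complex.conj_ofReal, neg_sub]
    push_cast
    ring
  refine ⟨fun t ↦ ((b t : ℝ) : ℂ), ⟨?_, ?_⟩, ?_, fun t => ?_, fun t ht ↦ ?_⟩
  · exact ofRealCLM.contDiff.comp b.contDiff
  · exact b.hasCompactSupport.comp_left Complex.ofReal_zero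
  · have h1 : tsupport (fun t ↦ ((b t : ℝ) : ℂ)) = tsupport b :=
      tsupport_comp_eq (g := fun x : ℝ ↦ (x : ℂ)) (fun {x} ↦ Complex.ofReal_eq_zero) b
    rw [h1, b.tsupport_eq, Real.closedBall_eq_Icc, zero_sub, zero_add]
  · rw [hval, Complex.ofReal_re]
    exact integral_nonneg fun u => mul_nonneg b.nonneg b.nonneg
  · rw [hval, Complex.ofReal_re]
    have hcont : Continuous fun u ↦ b u * b (u - t) :=
      b.continuous.mul (b.continuous.comp (continuous_sub_right t))
    have hcs : HasCompactSupport fun u ↦ b u * b (u - t) := b.hasCompactSupport.mul_right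
    refine hcont.integral_pos_of_hasCompactSupport_nonneg_nonzero hcs
      (fun u ↦ mul_nonneg b.nonneg b.nonneg) (x := t / 2) ?_
    have hmem : ∀ s : ℝ, |s| < a → b s ≠ 0 := fun s hs ↦ by
      refine (b.pos_of_mem_ball ?_).ne'
      simpa [Metric.mem_ball, Real.dist_eq] using hs
    refine mul_ne_zero (hmem _ ?_) (hmem _ ?_)
    · rw [abs_div, abs_two]; linarith
    · rw [show t / 2 - t = -(t / 2) by ring, abs_neg, abs_div, abs_two]; linarith

/-! ## The a-priori bound on one coordinate -/

/-- **A-priori bound.** Let `c ≥ 0` have unit slack against a Weil test `φ` whose autocorrelation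
`Φ = φ ⋆ φ̃` is node-nonnegative at EVERY node (`Re Φ(log m) ≥ 0`, all `m : ℕ`). Then every term of
`Re P_c(Φ) = Σₘ (c(m)/√m) 2 Re Φ(log m)` is `≥ 0`, the sum is at most `Re W_ar(Φ) + ‖φ‖₂²`, and so is its
`n`-th term; for `n ≥ 1` with `Re Φ(log n) > 0` this bounds the coordinate:
`c(n) ≤ √n (Re W_ar(Φ) + ‖φ‖₂²) / (2 Re Φ(log n))` (archive 2001 swcm, Step 2: `K♭_a` is compact). [folklore] -/
theorem fakeWeight_coord_le {c : ℕ → ℝ} (hc : ∀ n, 0 ≤ c n) {φ : ℝ → ℂ} (hφ : IsWeilTest φ)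
    (hnode : ∀ m : ℕ, 0 ≤ (weilConv φ (weilReflect φ) (Real.log m)).re)
    (hineq : -(∫ t, ‖φ t‖ ^ 2) ≤
      (weilPolarTerm (weilConv φ (weilReflect φ)) + weilArchTerm (weilConv φ (weilReflect φ)) -
        ∑' n : ℕ, ((c n : ℝ) : ℂ) / (Real.sqrt n : ℂ) *
          (weilConv φ (weilReflect φ) (Real.log n) + weilConv φ (weilReflect φ) (-Real.log n))).re)
    {n : ℕ} (hn : 1 ≤ n) (hpos : 0 < (weilConv φ (weilReflect φ) (Real.log n)).re) :
    c n ≤ Real.sqrt n *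
      ((weilPolarTerm (weilConv φ (weilReflect φ)) + weilArchTerm (weilConv φ (weilReflect φ))).re +
        ∫ t, ‖φ t‖ ^ 2) / (2 * (weilConv φ (weilReflect φ) (Real.log n)).re) := by
  set Φ := weilConv φ (weilReflect φ) with hΦ
  set T : ℕ → ℂ := fun m => ((c m : ℝ) : ℂ) / (Real.sqrt m : ℂ) * (Φ (Real.log m) + Φ (-Real.log m))
    with hT
  have hsumC : Summable T := summable_fakePrimeTerm c (hφ.weilConv hφ.weilReflect).2
  have hTre : ∀ m, (T m).re = c m / Real.sqrt m * (2 * (Φ (Real.log m)).re) := fun m =>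
    re_fakeTerm_weilConv_weilReflect c φ m
  have hTnn : ∀ m, 0 ≤ (T m).re := fun m => by
    rw [hTre]
    exact mul_nonneg (div_nonneg (hc m) (Real.sqrt_nonneg _)) (by nlinarith [hnode m])
  have hsumR : Summable fun m => (T m).re := by
    simpa using hsumC.mapL Complex.reCLM
  have hre : (∑' m, T m).re = ∑' m, (T m).re := Complex.re_tsum hsumC
  have hle : (T n).re ≤ ∑' m, (T m).re := hsumR.le_tsum n fun m _ => hTnn m
  -- the whole sum is at most `Re W_ar(Φ) + ‖φ‖₂²`
  have hS : (∑' m, T m).re ≤ (weilPolarTerm Φ + weilArchTerm Φ).re + ∫ t, ‖φ t‖ ^ 2 := by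
    have h := hineq
    rw [Complex.sub_re] at h
    linarith
  have hterm : c n / Real.sqrt n * (2 * (Φ (Real.log n)).re) ≤
      (weilPolarTerm Φ + weilArchTerm Φ).re + ∫ t, ‖φ t‖ ^ 2 := by
    rw [← hTre]
    linarith
  have hsq : 0 < Real.sqrt n := Real.sqrt_pos.2 (by exact_mod_cast hn)
  have h2 : 0 < 2 * (Φ (Real.log n)).re := by linarith
  rw [le_div_iff₀ h2]
  calc c n * (2 * (Φ (Real.log n)).re)
      = Real.sqrt n * (c n / Real.sqrt n * (2 * (Φ (Real.log n)).re)) := by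
        field_simp
    _ ≤ Real.sqrt n * ((weilPolarTerm Φ + weilArchTerm Φ).re + ∫ t, ‖φ t‖ ^ 2) :=
        mul_le_mul_of_nonneg_left hterm hsq.le

/-! ## Compactness: one weight for all cutoffs -/

/-- **Slack-cone compactness** (archive 2001 swcm, Step 2; W-MAG §1: `K♭_a` compact convex, decreasing
in `a`, so `⋂ₐ K♭_a ≠ ∅`). If at every cutoff `a > 0` some weight `c ≥ 0` with `c(1) = 0` has unit slack
against all Weil tests supported in `[-a, a]`, then ONE weight `c ≥ 0` with `c(1) = 0` has unit slack
against EVERY Weil test. Proof: a-priori bounds (`fakeWeight_coord_le` with the bumps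
`exists_nodeNonneg_bump` at the cutoffs `n + 1`), sequential compactness of `Πₙ [0, Bₙ] ⊆ ℝ^ℕ`, and passage to
the limit in the finitely many nodes seen by a fixed test (`fakeSum_eq_sum_range`). [folklore] -/
theorem exists_uniform_fakeWeight
    (h : ∀ a : ℝ, 0 < a → ∃ c : ℕ → ℝ, (∀ n, 0 ≤ c n) ∧ c 1 = 0 ∧ ∀ g : ℝ → ℂ, IsWeilTest g →
      tsupport g ⊆ Icc (-a) a →
      -(∫ t, ‖g t‖ ^ 2) ≤
        (weilPolarTerm (weilConv g (weilReflect g)) + weilArchTerm (weilConv g (weilReflect g)) -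
          ∑' n : ℕ, ((c n : ℝ) : ℂ) / (Real.sqrt n : ℂ) *
            (weilConv g (weilReflect g) (Real.log n) + weilConv g (weilReflect g) (-Real.log n))).re) :
    ∃ c : ℕ → ℝ, (∀ n, 0 ≤ c n) ∧ c 1 = 0 ∧ ∀ g : ℝ → ℂ, IsWeilTest g →
      -(∫ t, ‖g t‖ ^ 2) ≤
        (weilPolarTerm (weilConv g (weilReflect g)) + weilArchTerm (weilConv g (weilReflect g)) -
          ∑' n : ℕ, ((c n : ℝ) : ℂ) / (Real.sqrt n : ℂ) *
            (weilConv g (weilReflect g) (Real.log n) + weilConv g (weilReflect g) (-Real.log n))).re := by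
  -- Slater bumps at the cutoffs `n + 1`
  have hS : ∀ n : ℕ, ∃ φ : ℝ → ℂ, IsWeilTest φ ∧ tsupport φ ⊆ Icc (-((n : ℝ) + 1)) ((n : ℝ) + 1) ∧
      (∀ t : ℝ, 0 ≤ (weilConv φ (weilReflect φ) t).re) ∧
      ∀ t : ℝ, |t| < 2 * ((n : ℝ) + 1) → 0 < (weilConv φ (weilReflect φ) t).re := fun n =>
    exists_nodeNonneg_bump (a := (n : ℝ) + 1) (by positivity)
  choose φ hφ hφs hφnn hφp using hS
  -- weights at the integer cutoffs `k + 1`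
  have hk : ∀ k : ℕ, ∃ c : ℕ → ℝ, (∀ n, 0 ≤ c n) ∧ c 1 = 0 ∧ ∀ g : ℝ → ℂ, IsWeilTest g →
      tsupport g ⊆ Icc (-((k : ℝ) + 1)) ((k : ℝ) + 1) →
      -(∫ t, ‖g t‖ ^ 2) ≤
        (weilPolarTerm (weilConv g (weilReflect g)) + weilArchTerm (weilConv g (weilReflect g)) -
          ∑' n : ℕ, ((c n : ℝ) : ℂ) / (Real.sqrt n : ℂ) *
            (weilConv g (weilReflect g) (Real.log n) + weilConv g (weilReflect g) (-Real.log n))).re :=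
    fun k => h _ (by positivity)
  choose c hc0 hc1 hcin using hk
  -- node-nonnegativity and positivity of the Slater autocorrelations
  have hnode : ∀ n m : ℕ, 0 ≤ (weilConv (φ n) (weilReflect (φ n)) (Real.log m)).re := fun n m =>
    hφnn n _
  have hposn : ∀ n : ℕ, 1 ≤ n → 0 < (weilConv (φ n) (weilReflect (φ n)) (Real.log n)).re := by
    intro n hn
    refine hφp n _ ?_
    have hn0 : (0 : ℝ) < n := by exact_mod_cast hn
    rw [abs_of_nonneg (Real.log_natCast_nonneg n)]
    have := Real.log_le_sub_one_of_pos hn0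
    linarith
  -- the coordinate bounds `B n` and the a-priori estimate `c k n ≤ B n` for `1 ≤ n ≤ k`
  set B : ℕ → ℝ := fun n => Real.sqrt n *
    ((weilPolarTerm (weilConv (φ n) (weilReflect (φ n))) +
        weilArchTerm (weilConv (φ n) (weilReflect (φ n)))).re + ∫ t, ‖φ n t‖ ^ 2) /
      (2 * (weilConv (φ n) (weilReflect (φ n)) (Real.log n)).re) with hB
  have hapr : ∀ k n : ℕ, 1 ≤ n → n ≤ k → c k n ≤ B n := by
    intro k n hn hnk
    have hsub : Icc (-((n : ℝ) + 1)) ((n : ℝ) + 1) ⊆ Icc (-((k : ℝ) + 1)) ((k : ℝ) + 1) := by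
      have : (n : ℝ) ≤ k := by exact_mod_cast hnk
      exact Icc_subset_Icc (by linarith) (by linarith)
    exact fakeWeight_coord_le (hc0 k) (hφ n) (hnode n) (hcin k (φ n) (hφ n) ((hφs n).trans hsub))
      hn (hposn n hn)
  -- truncated weights in the compact box `Π [0, max (B n) 0]`
  set w : ℕ → ℕ → ℝ := fun k n => if 1 ≤ n ∧ n ≤ k then c k n else 0 with hw
  set K : Set (ℕ → ℝ) := Set.pi Set.univ fun n => Icc 0 (max (B n) 0) with hK
  have hKc : IsCompact K := isCompact_univ_pi fun _ => isCompact_Icc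
  have hwK : ∀ k, w k ∈ K := by
    intro k n _
    simp only [hw]
    split_ifs with hcase
    · exact ⟨hc0 k n, (hapr k n hcase.1 hcase.2).trans (le_max_left _ _)⟩
    · exact ⟨le_rfl, le_max_right _ _⟩
  obtain ⟨cl, hclK, ψ, hψ, hlim⟩ := hKc.isSeqCompact hwK
  have hlimn : ∀ n, Tendsto (fun k => w (ψ k) n) atTop (𝓝 (cl n)) := fun n =>
    tendsto_pi_nhds.1 hlim n
  refine ⟨cl, fun n => (hclK n (mem_univ _)).1, ?_, ?_⟩
  · -- `cl 1 = 0`: every `w k 1 = 0`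
    have h1 : ∀ k, w (ψ k) 1 = 0 := by
      intro k
      simp only [hw]
      split_ifs
      · exact hc1 _
      · rfl
    have : Tendsto (fun k => w (ψ k) 1) atTop (𝓝 0) := by
      simp only [h1]
      exact tendsto_const_nhds
    exact tendsto_nhds_unique (hlimn 1) this
  · -- unit slack against every Weil test
    intro g hg
    obtain ⟨R, hR⟩ := hg.2.isCompact.isBounded.subset_closedBall 0
    set a : ℝ := max R 1 with ha
    have ha0 : 0 < a := lt_of_lt_of_le one_pos (le_max_right _ _)
    have hsupp : tsupport g ⊆ Icc (-a) a := by
      intro t ht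
      have h' := hR ht
      rw [Metric.mem_closedBall, dist_zero_right, Real.norm_eq_abs] at h'
      have hRa : R ≤ a := le_max_left _ _
      exact ⟨by linarith [neg_abs_le t], by linarith [le_abs_self t]⟩
    set N : ℕ := ⌊Real.exp (2 * a)⌋₊ + 1 with hN
    set G := weilConv g (weilReflect g) with hG
    -- the term maps and the finite form of the fake sums
    set T : ℕ → ℝ → ℂ := fun n x => ((x : ℝ) : ℂ) / (Real.sqrt n : ℂ) *
      (G (Real.log n) + G (-Real.log n)) with hT
    have hfin : ∀ d : ℕ → ℝ, (∑' n : ℕ, ((d n : ℝ) : ℂ) / (Real.sqrt n : ℂ) *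
        (G (Real.log n) + G (-Real.log n))) = ∑ n ∈ Finset.range N, T n (d n) := fun d =>
      fakeSum_eq_sum_range hg hsupp d
    -- eventually the truncation is invisible to `g` and the cutoff `ψ k + 1` exceeds `a`
    have hev : ∀ᶠ k in atTop, -(∫ t, ‖g t‖ ^ 2) ≤
        (weilPolarTerm G + weilArchTerm G - ∑ n ∈ Finset.range N, T n (w (ψ k) n)).re := by
      refine (eventually_ge_atTop (max N ⌈a⌉₊)).mono fun k hk => ?_
      have hψk : k ≤ ψ k := hψ.id_le k
      have hNk : N ≤ ψ k := ((le_max_left _ _).trans hk).trans hψk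
      have hak : a ≤ (ψ k : ℝ) + 1 := by
        have h1 : (⌈a⌉₊ : ℝ) ≤ k := by exact_mod_cast (le_max_right _ _).trans hk
        have h2 : (k : ℝ) ≤ ψ k := by exact_mod_cast hψk
        linarith [Nat.le_ceil a]
      have hsub : Icc (-a) a ⊆ Icc (-((ψ k : ℝ) + 1)) ((ψ k : ℝ) + 1) :=
        Icc_subset_Icc (by linarith) hak
      have hineq := hcin (ψ k) g hg (hsupp.trans hsub)
      rw [hfin (c (ψ k))] at hineq
      have heq : ∑ n ∈ Finset.range N, T n (w (ψ k) n) = ∑ n ∈ Finset.range N, T n (c (ψ k) n) := by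
        refine Finset.sum_congr rfl fun n hn => ?_
        rw [Finset.mem_range] at hn
        rcases Nat.eq_zero_or_pos n with hn0 | hn0
        · subst hn0
          simp [hT]
        · have hcond : 1 ≤ n ∧ n ≤ ψ k := ⟨hn0, (hn.le.trans hNk)⟩
          simp only [hw, if_pos hcond]
      rwa [heq]
    -- the finite sums converge along the subsequence
    have hT_cont : ∀ n, Continuous (T n) := fun n => by
      simp only [hT]
      fun_prop
    have hlimS : Tendsto (fun k => ∑ n ∈ Finset.range N, T n (w (ψ k) n)) atTop
        (𝓝 (∑ n ∈ Finset.range N, T n (cl n))) :=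
      tendsto_finsetSum _ fun n _ => ((hT_cont n).tendsto (cl n)).comp (hlimn n)
    have hlimR : Tendsto (fun k => (weilPolarTerm G + weilArchTerm G -
        ∑ n ∈ Finset.range N, T n (w (ψ k) n)).re) atTop
        (𝓝 ((weilPolarTerm G + weilArchTerm G - ∑ n ∈ Finset.range N, T n (cl n)).re)) :=
      (Complex.continuous_re.tendsto _).comp (tendsto_const_nhds.sub hlimS)
    have hle := ge_of_tendsto hlimR hev
    rw [hfin cl]
    exact hle

/-! ## The route decl reduces to its uniform form -/

/-- **`ConeMagnification` is equivalent to its uniform form** (one weight for all cutoffs): the route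
decl `ConeMagnification` (hypothesis: a unit-slack weight at EVERY cutoff) holds iff
`(∃ c ≥ 0, c 1 = 0, unit slack against every Weil test) → RH` — W-MAG Thm 1.2(ii) with `M = 1`
(archive 2001 `rh-w-magnification/free/y1`). `→`: a uniform weight serves at every cutoff; `←`:
`exists_uniform_fakeWeight`. The route's Mathlib-primitive statement is definitionally the Literature
form used here. [folklore] -/
theorem coneMagnification_iff_uniform :
    Summit.RiemannHypothesis.RiemannHypothesis.Theses.SignCone.ConeMagnification ↔
      ((∃ c : ℕ → ℝ, (∀ n, 0 ≤ c n) ∧ c 1 = 0 ∧ ∀ g : ℝ → ℂ, IsWeilTest g →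
        -(∫ t, ‖g t‖ ^ 2) ≤
          (weilPolarTerm (weilConv g (weilReflect g)) + weilArchTerm (weilConv g (weilReflect g)) -
            ∑' n : ℕ, ((c n : ℝ) : ℂ) / (Real.sqrt n : ℂ) *
              (weilConv g (weilReflect g) (Real.log n) + weilConv g (weilReflect g) (-Real.log n))).re) →
        Summit.RiemannHypothesis) := by
  constructor
  · intro hCM ⟨c, hc0, hc1, hc⟩
    exact hCM fun a _ => ⟨c, hc0, hc1, fun g hg _ => hc g hg⟩
  · intro hU hfam
    exact hU (exists_uniform_fakeWeight hfam)

/-- **Reduction used by the route**: to prove the crux `ConeMagnification` it suffices to prove RH from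
ONE nonnegative weight `c` (`c 1 = 0`) whose fake Weil form `W_ar - P_c` has unit slack against every
Weil test (the uniform magnification theorem, W-MAG Thm 1.2(ii), `M = 1`). [folklore] -/
theorem coneMagnification_of_uniform
    (hU : (∃ c : ℕ → ℝ, (∀ n, 0 ≤ c n) ∧ c 1 = 0 ∧ ∀ g : ℝ → ℂ, IsWeilTest g →
        -(∫ t, ‖g t‖ ^ 2) ≤
          (weilPolarTerm (weilConv g (weilReflect g)) + weilArchTerm (weilConv g (weilReflect g)) -
            ∑' n : ℕ, ((c n : ℝ) : ℂ) / (Real.sqrt n : ℂ) *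
              (weilConv g (weilReflect g) (Real.log n) + weilConv g (weilReflect g) (-Real.log n))).re) →
        Summit.RiemannHypothesis) :
    Summit.RiemannHypothesis.RiemannHypothesis.Theses.SignCone.ConeMagnification :=
  coneMagnification_iff_uniform.2 hU

end Summit.RiemannHypothesis.RiemannHypothesis.Theorems.SignCone

end
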